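import Literature.Barriers.QuantumAdvantage.TensorNetworkContractionRecords
import Literature.Barriers.QuantumAdvantage.TensorNetworkContractionRootedSegments
import Literature.Barriers.QuantumAdvantage.TensorNetworkContractionPathDecompositionLists
import HarnessLib

/-!
# Barrier catalogue `QuantumAdvantage` — the contraction engine as list functions (Markov–Shi Thm 4.6, Steps 1, 3, 4)

Companion to `TensorNetworkContractionRecords.lean` (the segment tensor network of a Clifford+`T`
circuit as a list network `recList` of integer records over `ℤ[ω]`, segments numbered by their
position in `segList`), `TensorNetworkContractionRootedSegments.lean` (`segRooted`: the rooted
decomposition of the segment network induced by a supplied rooted decomposition `D` of the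
circuit graph — same parents, bag `i ↦` the segments carried by the nodes of `B_i`) and
`Literature/LinearAlgebra/TensorNetworks/JunctionTree.lean` (`JT.dpValue`, exact when the bags
house the scopes). The machine inhabiting `ContractionEngine` (`TensorNetworkContractionAssembly.lean`)
reads the description of the circuit and the code `D.encode` and must produce the same lists by
elementary operations; this file defines those operations and proves they are the right lists:

* rooted decompositions as lists: `rparList`, `rbagList`, `isRootedTD_rlists`;
* the segment numbering by lists: `canonL` (`canon_eq_canonL`), `canonBounds`, `segPairs`
  (`segList_map_pair`), `segNum` (`segIdx_eq_segNum`, `sn_eq_segNum`);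
* the scopes and the segment bags: `scopeNums` (`mem_scopeNums_code_iff`), `segBagOf`
  (**`segBagOf_eq`**: applied to the code list of `B_i` it is the sorted list of the numbers of
  `(segRooted D).bag i`), `segBagsOf`.

## References

* [MarkovShi2008] I. L. Markov, Y. Shi, SIAM J. Comput. 38 (2008) 963–981, §4 (Lemma 4.4, Thm 4.6), §3.
* S. Arora, B. Barak, *Computational Complexity*, CUP 2009, §0.1 (codes of lists).
-/

noncomputable section

namespace Literature.Barriers.QuantumAdvantage

open Literature.Computability.Cryptography Literature.Combinatorics.SimpleGraph
  Literature.Combinatorics.SimpleGraph.ListTD Literature.LinearAlgebra.TensorNetworks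

/-! ### Rooted decompositions as lists -/

namespace RootedTreeDecomposition

variable {V : Type*} {G : SimpleGraph V} {k : ℕ}

/-- The parent list `[parent 0, …, parent (k-1)]`. [folklore] -/
def rparList (D : RootedTreeDecomposition G k) : List ℕ := List.ofFn fun i : Fin k => ((D.parent i : Fin k) : ℕ)

/-- The bag list under a numbering `e` of the vertices: bag `i` ↦ the increasing list of the
numbers of its vertices. [folklore] -/
def rbagList [DecidableEq V] (D : RootedTreeDecomposition G k) (e : V → ℕ) : List (List ℕ) :=
  List.ofFn fun i : Fin k => ((D.bag i).image e).sort

/-- Reading the parent list. [folklore] -/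
theorem parOf_rparList (D : RootedTreeDecomposition G k) (i : Fin k) : parOf D.rparList i = D.parent i := by
  unfold parOf rparList
  rw [List.getD_eq_getElem?_getD, List.getElem?_ofFn]
  simp [i.isLt]

variable [DecidableEq V]

/-- Reading the bag list. [folklore] -/
theorem bagOf_rbagList (D : RootedTreeDecomposition G k) (e : V → ℕ) (i : Fin k) :
    bagOf (D.rbagList e) i = ((D.bag i).image e).sort := by
  unfold bagOf rbagList
  rw [List.getD_eq_getElem?_getD, List.getElem?_ofFn]
  simp [i.isLt]

/-- Beyond the last bag the bag list reads `[]`. [folklore] -/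
theorem bagOf_rbagList_of_le (D : RootedTreeDecomposition G k) (e : V → ℕ) {t : ℕ} (ht : k ≤ t) :
    bagOf (D.rbagList e) t = [] := by
  unfold bagOf rbagList
  rw [List.getD_eq_getElem?_getD, List.getElem?_eq_none (by simp; omega)]
  rfl

/-- Membership in a listed bag. [folklore] -/
theorem mem_bagOf_rbagList (D : RootedTreeDecomposition G k) {e : V → ℕ} (he : Function.Injective e) (i : Fin k) (v : V) :
    e v ∈ bagOf (D.rbagList e) i ↔ v ∈ D.bag i := by
  rw [bagOf_rbagList, Finset.mem_sort, Finset.mem_image]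
  exact ⟨fun ⟨u, hu, huv⟩ => he huv ▸ hu, fun h => ⟨v, h, rfl⟩⟩

/-- Lengths of the lists. [folklore] -/
theorem length_rbagList (D : RootedTreeDecomposition G k) (e : V → ℕ) : (D.rbagList e).length = k := List.length_ofFn

/-- The listed bag is no larger than the bag. [folklore] -/
theorem length_bagOf_rbagList_le (D : RootedTreeDecomposition G k) (e : V → ℕ) (t : ℕ) :
    (bagOf (D.rbagList e) t).length ≤ Finset.univ.sup fun i => (D.bag i).card := by
  by_cases ht : t < k
  · rw [D.bagOf_rbagList e ⟨t, ht⟩, Finset.length_sort]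
    exact Finset.card_image_le.trans (Finset.le_sup (f := fun i => (D.bag i).card) (Finset.mem_univ _))
  · rw [D.bagOf_rbagList_of_le e (not_lt.1 ht)]; exact Nat.zero_le _

/-- **A rooted tree decomposition, listed, is a rooted list decomposition** of the numbers
`0, …, n-1` (numbering by an equivalence with `Fin n`). [cite: MarkovShi2008, §4 (Thm 4.6, Step 2)] -/
theorem isRootedTD_rlists [Fintype V] {n : ℕ} (D : RootedTreeDecomposition G k) (e : V ≃ Fin n) :
    IsRootedTD n D.rparList (D.rbagList fun v => ((e v : Fin n) : ℕ)) := by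
  have he : Function.Injective fun v => ((e v : Fin n) : ℕ) := fun a b h => e.injective (Fin.ext h)
  have hlen := D.length_rbagList (fun v => ((e v : Fin n) : ℕ))
  refine ⟨by rw [hlen]; exact List.length_ofFn, by rw [hlen]; exact D.pos, fun t h0 ht => ?_, fun t x hx => ?_,
    fun t => ?_, fun x hx => ?_, fun x s t hst ht hxt hxs => ?_⟩
  · rw [hlen] at ht
    rw [D.parOf_rparList ⟨t, ht⟩]
    exact D.parent_lt ⟨t, ht⟩ h0
  · by_cases ht : t < k
    · rw [D.bagOf_rbagList _ ⟨t, ht⟩, Finset.mem_sort, Finset.mem_image] at hx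
      obtain ⟨v, -, rfl⟩ := hx
      exact Finset.mem_range.2 (Fin.isLt _)
    · rw [D.bagOf_rbagList_of_le _ (not_lt.1 ht)] at hx; simp at hx
  · by_cases ht : t < k
    · rw [D.bagOf_rbagList _ ⟨t, ht⟩]; exact Finset.sort_nodup _ _
    · rw [D.bagOf_rbagList_of_le _ (not_lt.1 ht)]; exact List.nodup_nil
  · obtain ⟨i, hi⟩ := D.exists_mem_bag (e.symm ⟨x, Finset.mem_range.1 hx⟩)
    refine ⟨i, by rw [hlen]; exact i.isLt, ?_⟩
    have := (D.mem_bagOf_rbagList he i (e.symm ⟨x, Finset.mem_range.1 hx⟩)).2 hi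
    simpa using this
  · rw [hlen] at ht
    have hs : s < k := hst.trans ht
    rw [D.bagOf_rbagList _ ⟨t, ht⟩, Finset.mem_sort, Finset.mem_image] at hxt
    obtain ⟨v, hvt, rfl⟩ := hxt
    have hvs : v ∈ D.bag ⟨s, hs⟩ := (D.mem_bagOf_rbagList he ⟨s, hs⟩ v).1 hxs
    have := D.mem_bag_parent v ⟨t, ht⟩ hvt ⟨⟨s, hs⟩, hvs, hst⟩
    rw [show parOf D.rparList t = ((D.parent ⟨t, ht⟩ : Fin k) : ℕ) from D.parOf_rparList ⟨t, ht⟩]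
    exact (D.mem_bagOf_rbagList he _ v).2 this

end RootedTreeDecomposition

/-! ### The segment numbering by lists -/

variable {N : ℕ}

/-- **The start of the segment alive at `t` on wire `w`**, by lists: one past the last gate on `w`
among the first `t`, else `0`. [folklore] -/
def canonL (wl : List (List ℕ)) (w t : ℕ) : ℕ :=
  match ((gateTimesOn wl w).filter fun t' => decide (t' + 1 ≤ t)).getLast? with
  | some t' => t' + 1
  | none => 0

/-- In an increasing list the maximum is the last element. [folklore] -/
theorem getLast?_eq_of_max {l : List ℕ} (hl : l.Pairwise (· < ·)) {m : ℕ} (hm : m ∈ l) (hmax : ∀ x ∈ l, x ≤ m) :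
    l.getLast? = some m := by
  have hne : l ≠ [] := List.ne_nil_of_mem hm
  obtain ⟨ys, a, rfl⟩ : ∃ ys a, l = ys ++ [a] := ⟨l.dropLast, l.getLast hne, (List.dropLast_append_getLast hne).symm⟩
  rw [List.getLast?_eq_some_iff]
  refine ⟨ys, ?_⟩
  rw [List.pairwise_append] at hl
  rcases List.mem_append.1 hm with h | h
  · have h1 : m < a := hl.2.2 m h a (List.mem_singleton_self a)
    have h2 : a ≤ m := hmax a (List.mem_append_right _ (List.mem_singleton_self a))
    omega
  · rw [List.mem_singleton.1 h]

section Canon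

variable {G : QGateSet} (C : QCircuit G N)

/-- Membership in `gateTimesOn`, by wires. [folklore] -/
theorem mem_gateTimesOn_iff' {w : Fin N} {t : ℕ} :
    t ∈ gateTimesOn (wlOf C) w ↔ ∃ h : t < C.gates.length, w ∈ (C.gates[t]).wires := by
  rw [mem_gateTimesOn_iff]
  exact ⟨fun ⟨h, ho⟩ => ⟨h, ho⟩, fun ⟨h, ho⟩ => ⟨h, ho⟩⟩

/-- The recursion of `canonL`. [folklore] -/
theorem canonL_succ (w : Fin N) {t : ℕ} (ht : t < C.gates.length) :
    canonL (wlOf C) w (t + 1) = if w ∈ (C.gates[t]).wires then t + 1 else canonL (wlOf C) w t := by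
  have hGpw : (gateTimesOn (wlOf C) w).Pairwise (· < ·) := pairwise_lt_filter_range _ _
  unfold canonL
  by_cases hw : w ∈ (C.gates[t]).wires
  · rw [if_pos hw]
    have htG : t ∈ gateTimesOn (wlOf C) w := (mem_gateTimesOn_iff' C).2 ⟨ht, hw⟩
    have hmem : t ∈ (gateTimesOn (wlOf C) w).filter fun t' => decide (t' + 1 ≤ t + 1) :=
      List.mem_filter.2 ⟨htG, by simp⟩
    rw [getLast?_eq_of_max (hGpw.filter _) hmem fun x hx => by simpa using (List.mem_filter.1 hx).2]
  · rw [if_neg hw]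
    have hfilt : ((gateTimesOn (wlOf C) w).filter fun t' => decide (t' + 1 ≤ t + 1)) =
        (gateTimesOn (wlOf C) w).filter fun t' => decide (t' + 1 ≤ t) := by
      refine List.filter_congr fun x hx => ?_
      have hxt : x ≠ t := fun h => hw (h ▸ ((mem_gateTimesOn_iff' C).1 hx).2)
      by_cases h : x + 1 ≤ t <;> simp [h] <;> omega
    rw [hfilt]

/-- `canonL` at `0`. [folklore] -/
theorem canonL_zero (w : Fin N) : canonL (wlOf C) w 0 = 0 := by
  unfold canonL
  rw [show ((gateTimesOn (wlOf C) w).filter fun t' => decide (t' + 1 ≤ 0)) = [] from List.filter_eq_nil_iff.2 (by simp)]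
  rfl

/-- **`canon` by lists.** [folklore] -/
theorem canon_eq_canonL (w : Fin N) : ∀ {t : ℕ}, t ≤ C.gates.length → canon C w t = canonL (wlOf C) w t
  | 0, _ => by rw [canon_zero, canonL_zero]
  | t + 1, ht => by
    have htT : t < C.gates.length := ht
    rw [canonL_succ C w htT, ← canon_eq_canonL w (Nat.le_of_lt htT)]
    by_cases hw : w ∈ (C.gates[t]).wires
    · rw [if_pos hw, canon_succ_of_mem htT hw]
    · rw [if_neg hw, canon_succ_of_not_mem htT hw]

/-- A boundary is the start of a segment iff it is `0` or follows a gate on the wire. [folklore] -/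
theorem canon_eq_self_iff (w : Fin N) {t : ℕ} (ht : t ≤ C.gates.length) :
    canon C w t = t ↔ t = 0 ∨ ∃ t', t = t' + 1 ∧ ∃ h : t' < C.gates.length, w ∈ (C.gates[t']).wires := by
  cases t with
  | zero => simp
  | succ t' =>
    have ht' : t' < C.gates.length := ht
    constructor
    · intro h
      by_cases hw : w ∈ (C.gates[t']).wires
      · exact Or.inr ⟨t', rfl, ht', hw⟩
      · rw [canon_succ_of_not_mem ht' hw] at h
        have := canon_le C w t'
        omega
    · rintro (h | ⟨t'', h, ht'', hw⟩)
      · omega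
      · have : t'' = t' := by omega
        subst this
        exact canon_succ_of_mem ht' hw

end Canon

/-- **The starts of the segments of wire `w`**, increasing: `0` and one past every gate on `w`. [folklore] -/
def canonBounds (wl : List (List ℕ)) (w : ℕ) : List ℕ := 0 :: (gateTimesOn wl w).map (· + 1)

/-- **The segments as pairs** `(wire, start)`, wire by wire. [folklore] -/
def segPairs (wl : List (List ℕ)) (N : ℕ) : List (ℕ × ℕ) := (List.range N).flatMap fun w => (canonBounds wl w).map fun b => (w, b)

/-- **The number of the segment `(w, b)`**: its position among the pairs. [folklore] -/
def segNum (wl : List (List ℕ)) (N : ℕ) (w b : ℕ) : ℕ := (segPairs wl N).findIdx fun q => q == (w, b)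

section Numbering

variable (C : QCircuit cliffordT N)

/-- The canonical boundaries of a wire, filtered from the range, are `canonBounds`. [folklore] -/
theorem filter_canon_eq_canonBounds (w : Fin N) :
    ((List.finRange (C.gates.length + 1)).filter fun t : Fin (C.gates.length + 1) => decide (canon C w (t : ℕ) = (t : ℕ))).map
        Fin.val = canonBounds (wlOf C) w := by
  refine List.SortedLT.eq_of_mem_iff ?_ ?_ fun b => ?_
  · rw [List.sortedLT_iff_pairwise, List.pairwise_map]
    exact List.Pairwise.filter _ ((List.pairwise_lt_finRange _).imp fun h => h)
  · rw [List.sortedLT_iff_pairwise, canonBounds, List.pairwise_cons, List.pairwise_map]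
    exact ⟨fun b hb => by obtain ⟨t, -, rfl⟩ := List.mem_map.1 hb; omega,
      (pairwise_lt_filter_range _ _).imp fun h => by omega⟩
  · simp only [List.mem_map, List.mem_filter, List.mem_finRange, true_and, decide_eq_true_eq, canonBounds, List.mem_cons]
    constructor
    · rintro ⟨t, ht, rfl⟩
      rcases (canon_eq_self_iff C w (Nat.lt_succ_iff.1 t.isLt)).1 ht with h | ⟨t', h, ht', hw⟩
      · exact Or.inl h
      · exact Or.inr ⟨t', (mem_gateTimesOn_iff' C).2 ⟨ht', hw⟩, h.symm⟩
    · rintro (rfl | ⟨t', ht', rfl⟩)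
      · exact ⟨⟨0, Nat.succ_pos _⟩, rfl, rfl⟩
      · obtain ⟨hT, hw⟩ := (mem_gateTimesOn_iff' C).1 ht'
        exact ⟨⟨t' + 1, by omega⟩, canon_succ_of_mem hT hw, rfl⟩

/-- **The segment list, as pairs, is `segPairs`.** [folklore] -/
theorem segList_map_pair :
    (segList C).map (fun s => (((s.1.1 : Fin N) : ℕ), ((s.1.2 : Fin (C.gates.length + 1)) : ℕ))) = segPairs (wlOf C) N := by
  rw [segPairs, ← List.map_coe_finRange_eq_range, List.flatMap_map, segList, List.map_flatMap]
  refine List.flatMap_congr fun w _ => ?_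
  rw [List.map_map, ← filter_canon_eq_canonBounds C w, List.map_map]
  refine List.map_congr_left fun t ht => ?_
  have hc : canon C w t = t := by simpa using (List.mem_filter.1 ht).2
  simp [segAt, hc]

/-- `findIdx` of pointwise equal tests. [folklore] -/
theorem findIdx_congr' {α : Type*} {p q : α → Bool} : ∀ {l : List α}, (∀ x ∈ l, p x = q x) → l.findIdx p = l.findIdx q
  | [], _ => rfl
  | x :: l, h => by
    rw [List.findIdx_cons, List.findIdx_cons, h x List.mem_cons_self,
      findIdx_congr' fun y hy => h y (List.mem_cons_of_mem _ hy)]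

/-- **The number of a segment is its position among the pairs.** [folklore] -/
theorem segIdx_eq_segNum (s : Seg C) : ((segIdx C s : Fin (segCount C)) : ℕ) = segNum (wlOf C) N s.1.1 s.1.2 := by
  have h1 : ((segIdx C s : Fin (segCount C)) : ℕ) = (segList C).idxOf s := rfl
  rw [h1, segNum, ← segList_map_pair C, List.findIdx_map, List.idxOf]
  refine findIdx_congr' fun s' _ => ?_
  simp only [Function.comp]
  by_cases h : s' = s
  · subst h; simp
  · have hne : ¬ ((((s'.1.1 : Fin N) : ℕ), ((s'.1.2 : Fin _) : ℕ)) = (((s.1.1 : Fin N) : ℕ), ((s.1.2 : Fin _) : ℕ))) := by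
      intro heq
      obtain ⟨ha, hb⟩ := Prod.mk.inj heq
      exact h (Subtype.ext (Prod.ext (Fin.ext ha) (Fin.ext hb)))
    simp [h, hne]

/-- **The number of the segment alive at `t` on wire `w`.** [folklore] -/
theorem sn_eq_segNum (w : Fin N) (t : Fin (C.gates.length + 1)) :
    sn C w t = segNum (wlOf C) N w (canonL (wlOf C) w t) := by
  rw [sn, segIdx_eq_segNum, ← canon_eq_canonL C w (Nat.lt_succ_iff.1 t.isLt)]
  rfl

/-- The number of segments is the number of pairs. [folklore] -/
theorem segCount_eq_length_segPairs : segCount C = (segPairs (wlOf C) N).length := by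
  rw [← segList_map_pair C, List.length_map]; rfl

/-! ### Scopes and segment bags by lists -/

/-- **The numbers of the segments read by the node of code `c`**: an input `w` reads `(w, 0)`;
gate `t` reads, for each of its wires `w`, the segment alive at `t` and the one starting at `t+1`;
an output `w` reads the segment alive at `T`. [cite: MarkovShi2008, §3 (the network N(C))] -/
def scopeNums (wl : List (List ℕ)) (N : ℕ) (c : ℕ) : List ℕ :=
  if c < N then [segNum wl N c 0]
  else if c < N + wl.length then
    (wl.getD (c - N) []).flatMap fun w => [segNum wl N w (canonL wl w (c - N)), segNum wl N w (canonL wl w (c - N + 1))]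
  else [segNum wl N (c - N - wl.length) (canonL wl (c - N - wl.length) wl.length)]

variable {C}

/-- **`scopeNums` of the code of a node are the numbers of its scope.** [folklore] -/
theorem mem_scopeNums_code_iff (A : Language Bool) (z₀ : QReg N) (obs : Fin N → Bool → ℂ)
    (u : CircuitNode C.gates.length N) (x : ℕ) :
    x ∈ scopeNums (wlOf C) N u.code ↔ ∃ s ∈ (segmentNetwork C A z₀ obs).scope u, ((segIdx C s : Fin (segCount C)) : ℕ) = x := by
  have hT : (wlOf C).length = C.gates.length := List.length_map _
  cases u with
  | input w =>
    have hsn : segNum (wlOf C) N w 0 = sn C w 0 := by rw [sn_eq_segNum]; congr 1; exact (canonL_zero C w).symm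
    simp only [CircuitNode.code, scopeNums, if_pos w.isLt, List.mem_singleton, segmentNetwork, Finset.mem_singleton,
      exists_eq_left, hsn, sn, eq_comm]
  | gate t =>
    have h1 : ¬ (N + (t : ℕ) < N) := by omega
    have h2 : N + (t : ℕ) < N + (wlOf C).length := by rw [hT]; have := t.isLt; omega
    simp only [CircuitNode.code, scopeNums, if_neg h1, if_pos h2, Nat.add_sub_cancel_left, List.mem_flatMap,
      List.mem_cons, List.not_mem_nil, or_false, segmentNetwork, Finset.mem_biUnion, Finset.mem_insert, Finset.mem_singleton]
    rw [wlOf_getD t.isLt]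
    constructor
    · rintro ⟨w, hw, hx⟩
      have hwN := lt_of_mem_wireListOf hw
      have hw' : (⟨w, hwN⟩ : Fin N) ∈ (C.gates[(t : ℕ)]).wires := mem_wires_iff.2 hw
      rcases hx with rfl | rfl
      · exact ⟨segAt C ⟨w, hwN⟩ t.castSucc, ⟨⟨w, hwN⟩, hw', Or.inl rfl⟩, by
          show sn C ⟨w, hwN⟩ t.castSucc = _; rw [sn_eq_segNum]; rfl⟩
      · exact ⟨segAt C ⟨w, hwN⟩ t.succ, ⟨⟨w, hwN⟩, hw', Or.inr rfl⟩, by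
          show sn C ⟨w, hwN⟩ t.succ = _; rw [sn_eq_segNum]; rfl⟩
    · rintro ⟨s, ⟨w', hw', hs⟩, rfl⟩
      refine ⟨(w' : ℕ), mem_wires_iff.1 hw', ?_⟩
      rcases hs with rfl | rfl
      · left; show sn C w' t.castSucc = _; rw [sn_eq_segNum]; rfl
      · right; show sn C w' t.succ = _; rw [sn_eq_segNum]; rfl
  | output w =>
    have h1 : ¬ (N + C.gates.length + (w : ℕ) < N) := by omega
    have h2 : ¬ (N + C.gates.length + (w : ℕ) < N + C.gates.length) := by omega
    have h3 : N + C.gates.length + (w : ℕ) - N - C.gates.length = w := by omega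
    have hsn : segNum (wlOf C) N w (canonL (wlOf C) w C.gates.length) = sn C w (Fin.last _) := by rw [sn_eq_segNum]; rfl
    simp only [CircuitNode.code, scopeNums, hT, if_neg h1, if_neg h2, h3, List.mem_singleton, segmentNetwork,
      Finset.mem_singleton, exists_eq_left, hsn, sn, eq_comm]

/-- **The segment bag of a bag of nodes**, from their codes: the increasing list of the numbers
of the segments they read (Lemma 4.4's bag `⋃_{u ∈ B_i} scope u`). [cite: MarkovShi2008, §4 (Lemma 4.4)] -/
def segBagOf (wl : List (List ℕ)) (N : ℕ) (codes : List ℕ) : List ℕ := sortDedup (codes.flatMap (scopeNums wl N))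

/-- **`segBagOf` of the code list of `B_i` is the sorted number list of the `i`-th segment bag.**
[cite: MarkovShi2008, §4 (Lemma 4.4)] -/
theorem segBagOf_eq (A : Language Bool) (z₀ : QReg N) (obs : Fin N → Bool → ℂ) {k : ℕ}
    (D : RootedTreeDecomposition (circuitGraph C) k) (i : Fin k) :
    segBagOf (wlOf C) N (((D.bag i).image CircuitNode.code).sort) =
      (((segRooted C A z₀ obs D).bag i).image fun s => ((segIdx C s : Fin (segCount C)) : ℕ)).sort := by
  refine List.SortedLT.eq_of_mem_iff (List.sortedLT_iff_pairwise.2 (sortDedup_spec _).1) (Finset.sortedLT_sort _) fun x => ?_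
  rw [segBagOf, (sortDedup_spec _).2, List.mem_flatMap, Finset.mem_sort, Finset.mem_image, segRooted_bag]
  simp only [Finset.mem_sort, Finset.mem_image, Finset.mem_biUnion]
  constructor
  · rintro ⟨c, ⟨u, hu, rfl⟩, hx⟩
    obtain ⟨s, hs, rfl⟩ := (mem_scopeNums_code_iff A z₀ obs u x).1 hx
    exact ⟨s, ⟨u, hu, hs⟩, rfl⟩
  · rintro ⟨s, ⟨u, hu, hs⟩, rfl⟩
    exact ⟨u.code, ⟨u, hu, rfl⟩, (mem_scopeNums_code_iff A z₀ obs u _).2 ⟨s, hs, rfl⟩⟩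

/-- **The listed segment decomposition from the listed node decomposition**: same parents, bags
`segBagOf` of the code lists. [cite: MarkovShi2008, §4 (Lemma 4.4)] -/
theorem rbagList_segRooted (A : Language Bool) (z₀ : QReg N) (obs : Fin N → Bool → ℂ) {k : ℕ}
    (D : RootedTreeDecomposition (circuitGraph C) k) :
    (segRooted C A z₀ obs D).rbagList (fun s => ((segIdx C s : Fin (segCount C)) : ℕ)) =
      (D.rbagList CircuitNode.code).map (segBagOf (wlOf C) N) := by
  unfold RootedTreeDecomposition.rbagList
  rw [List.map_ofFn]
  congr 1
  funext i
  exact (segBagOf_eq A z₀ obs D i).symm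

/-- `segRooted` keeps the parent list. [folklore] -/
theorem rparList_segRooted (A : Language Bool) (z₀ : QReg N) (obs : Fin N → Bool → ℂ) {k : ℕ}
    (D : RootedTreeDecomposition (circuitGraph C) k) : (segRooted C A z₀ obs D).rparList = D.rparList := rfl

/-- **The code of a rooted decomposition is the pair code of its lists.** [cite: AroraBarak2009, §0.1] -/
theorem encode_eq_lists {k : ℕ} (D : RootedTreeDecomposition (circuitGraph C) k) :
    D.encode = Literature.Computability.Complexity.CodeFP.pairE
      (Literature.Computability.Complexity.CodeFP.listE Literature.Computability.Complexity.CodeFP.natE)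
      (Literature.Computability.Complexity.CodeFP.listE (Literature.Computability.Complexity.CodeFP.listE
        Literature.Computability.Complexity.CodeFP.natE)) (D.rparList, D.rbagList CircuitNode.code) := by
  rw [RootedTreeDecomposition.encode, Literature.Computability.Complexity.CodeFP.pairE_eq,
    Literature.Computability.Complexity.CodeFP.listE_eq, Literature.Computability.Complexity.CodeFP.listE_eq,
    Literature.Computability.Complexity.CodeFP.listE_eq, Literature.Computability.Complexity.CodeFP.natE_eq]
  rfl

/-! ### The records by lists -/

/-- **The kind of a gate** (the kind numbering of `NodeRec`): `H ↦ 1`, `S ↦ 2`, `T ↦ 3`, `CNOT ↦ 4`,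
oracle `↦ 6` (dead). [folklore] -/
def opKind : QGate cliffordT N → ℕ
  | .gate .H _ => 1
  | .gate .S _ => 2
  | .gate .T _ => 3
  | .gate .CNOT _ => 4
  | .oracle _ _ => 6

/-- The kind of a placed gate is one more than the code of its symbol. [folklore] -/
theorem opKind_gate (op : CliffordTOp) (e : Fin (cliffordT.arity op) ↪ Fin N) :
    opKind (QGate.gate (G := cliffordT) op e) = Encodable.encode op + 1 := by
  cases op <;> rfl

/-- The kinds of the gates of a circuit. [folklore] -/
abbrev opsOf (C : QCircuit cliffordT N) : List ℕ := C.gates.map opKind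

/-- **The record of the node of code `c`**, from the wire lists `wl`, the kinds `ops` and the
input bits `xb` (input `|x 0…0⟩`, wire `0` measured). [cite: MarkovShi2008, §3 (the network N(C; x, τ))] -/
def recOfCode (wl : List (List ℕ)) (N : ℕ) (ops : List ℕ) (xb : List Bool) (c : ℕ) : NodeRec :=
  if c < N then .input (segNum wl N c 0) (xb.getD c false)
  else if c < N + wl.length then
    (if ops.getD (c - N) 6 = 1 then
      .gateH (segNum wl N ((wl.getD (c - N) []).getD 0 0) (canonL wl ((wl.getD (c - N) []).getD 0 0) (c - N)))
        (segNum wl N ((wl.getD (c - N) []).getD 0 0) (canonL wl ((wl.getD (c - N) []).getD 0 0) (c - N + 1)))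
    else if ops.getD (c - N) 6 = 2 then
      .gateS (segNum wl N ((wl.getD (c - N) []).getD 0 0) (canonL wl ((wl.getD (c - N) []).getD 0 0) (c - N)))
        (segNum wl N ((wl.getD (c - N) []).getD 0 0) (canonL wl ((wl.getD (c - N) []).getD 0 0) (c - N + 1)))
    else if ops.getD (c - N) 6 = 3 then
      .gateT (segNum wl N ((wl.getD (c - N) []).getD 0 0) (canonL wl ((wl.getD (c - N) []).getD 0 0) (c - N)))
        (segNum wl N ((wl.getD (c - N) []).getD 0 0) (canonL wl ((wl.getD (c - N) []).getD 0 0) (c - N + 1)))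
    else if ops.getD (c - N) 6 = 4 then
      .gateCNOT (segNum wl N ((wl.getD (c - N) []).getD 0 0) (canonL wl ((wl.getD (c - N) []).getD 0 0) (c - N)))
        (segNum wl N ((wl.getD (c - N) []).getD 1 0) (canonL wl ((wl.getD (c - N) []).getD 1 0) (c - N)))
        (segNum wl N ((wl.getD (c - N) []).getD 0 0) (canonL wl ((wl.getD (c - N) []).getD 0 0) (c - N + 1)))
        (segNum wl N ((wl.getD (c - N) []).getD 1 0) (canonL wl ((wl.getD (c - N) []).getD 1 0) (c - N + 1)))
    else .dead)
  else .output (segNum wl N (c - N - wl.length) (canonL wl (c - N - wl.length) wl.length)) (decide (c - N - wl.length = 0))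

/-- **The record list by lists.** [folklore] -/
def recListL (wl : List (List ℕ)) (N : ℕ) (ops : List ℕ) (xb : List Bool) : List NodeRec :=
  (List.range (2 * N + wl.length)).map (recOfCode wl N ops xb)

/-- Entries of `wireListOf (gate op e)`. [folklore] -/
theorem wireListOf_gate_getD {op : CliffordTOp} (e : Fin (cliffordT.arity op) ↪ Fin N) (i : ℕ) (hi : i < cliffordT.arity op) :
    (wireListOf (QGate.gate (G := cliffordT) op e)).getD i 0 = ((e ⟨i, hi⟩ : Fin N) : ℕ) := by
  unfold wireListOf
  rw [List.getD_eq_getElem?_getD, List.getElem?_ofFn]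
  simp [hi]

/-- **The record of the node of code `c` is `recOf`** (oracle-free circuit on `N > 0` wires,
input bits `xb`, wire `0` measured). [folklore] -/
theorem recOfCode_code (hN : 0 < N) {xb : List Bool} {z₀ : QReg N} (hz : ∀ w : Fin N, z₀ w = xb.getD w false)
    (u : CircuitNode C.gates.length N) :
    recOfCode (wlOf C) N (opsOf C) xb u.code = recOf C z₀ ⟨0, hN⟩ u := by
  have hT : (wlOf C).length = C.gates.length := List.length_map _
  cases u with
  | input w =>
    have hsn : segNum (wlOf C) N w 0 = sn C w 0 := by rw [sn_eq_segNum]; congr 1; exact (canonL_zero C w).symm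
    simp only [CircuitNode.code, recOfCode, if_pos w.isLt, recOf, hsn, hz]
  | gate t =>
    have h1 : ¬ (N + (t : ℕ) < N) := by omega
    have h2 : N + (t : ℕ) < N + C.gates.length := by have := t.isLt; omega
    have hops : (opsOf C).getD (t : ℕ) 6 = opKind C.gates[(t : ℕ)] := by
      rw [List.getD_eq_getElem?_getD, List.getElem?_map, List.getElem?_eq_getElem t.isLt]; rfl
    have hi : ∀ w : Fin N, segNum (wlOf C) N w (canonL (wlOf C) w t) = sn C w t.castSucc := fun w => by rw [sn_eq_segNum]; rfl
    have ho : ∀ w : Fin N, segNum (wlOf C) N w (canonL (wlOf C) w (t + 1)) = sn C w t.succ := fun w => by rw [sn_eq_segNum]; rfl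
    simp only [CircuitNode.code, recOfCode, hT, if_neg h1, if_pos h2, Nat.add_sub_cancel_left, hops, wlOf_getD t.isLt, recOf]
    rcases hg : C.gates[(t : ℕ)] with ⟨op, e⟩ | ⟨k, e⟩
    · cases op
      · simp only [opKind, if_true]
        rw [wireListOf_gate_getD e 0 (by decide), hi, ho]; rfl
      · simp only [opKind, show (2 : ℕ) ≠ 1 from by decide, if_false, if_true]
        rw [wireListOf_gate_getD e 0 (by decide), hi, ho]; rfl
      · simp only [opKind, show (3 : ℕ) ≠ 1 from by decide, show (3 : ℕ) ≠ 2 from by decide, if_false, if_true]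
        rw [wireListOf_gate_getD e 0 (by decide), hi, ho]; rfl
      · simp only [opKind, show (4 : ℕ) ≠ 1 from by decide, show (4 : ℕ) ≠ 2 from by decide, show (4 : ℕ) ≠ 3 from by decide,
          if_false, if_true]
        rw [wireListOf_gate_getD e 0 (by decide), wireListOf_gate_getD e 1 (by decide), hi, ho, hi, ho]; rfl
    · simp only [opKind, show (6 : ℕ) ≠ 1 from by decide, show (6 : ℕ) ≠ 2 from by decide, show (6 : ℕ) ≠ 3 from by decide,
        show (6 : ℕ) ≠ 4 from by decide, if_false]
  | output w =>
    have h1 : ¬ (N + C.gates.length + (w : ℕ) < N) := by omega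
    have h2 : ¬ (N + C.gates.length + (w : ℕ) < N + C.gates.length) := by omega
    have h3 : N + C.gates.length + (w : ℕ) - N - C.gates.length = w := by omega
    have hsn : segNum (wlOf C) N w (canonL (wlOf C) w C.gates.length) = sn C w (Fin.last _) := by rw [sn_eq_segNum]; rfl
    have hdec : decide ((w : ℕ) = 0) = decide (w = ⟨0, hN⟩) := by simp [Fin.ext_iff]
    simp only [CircuitNode.code, recOfCode, hT, if_neg h1, if_neg h2, h3, hsn, recOf, hdec]

/-- The node list through the codes. [folklore] -/
theorem nodeList_eq_map_code (T N : ℕ) : (nodeList T N).map CircuitNode.code = List.range (2 * N + T) := by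
  simp only [nodeList, List.map_append, List.map_map]
  have h1 : (List.finRange N).map (CircuitNode.code ∘ (CircuitNode.input (T := T))) = List.range N := by
    rw [show (CircuitNode.code ∘ CircuitNode.input (T := T) (N := N)) = Fin.val from rfl, List.map_coe_finRange_eq_range]
  have h2 : (List.finRange T).map (CircuitNode.code ∘ (CircuitNode.gate (N := N))) = List.range' N T := by
    rw [show (CircuitNode.code ∘ CircuitNode.gate (T := T) (N := N)) = (fun i => N + i) ∘ Fin.val from rfl,
      ← List.map_map, List.map_coe_finRange_eq_range, List.range_eq_range', List.map_add_range']
    simp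
  have h3 : (List.finRange N).map (CircuitNode.code ∘ (CircuitNode.output (T := T))) = List.range' (N + T) N := by
    rw [show (CircuitNode.code ∘ CircuitNode.output (T := T) (N := N)) = (fun i => N + T + i) ∘ Fin.val from rfl,
      ← List.map_map, List.map_coe_finRange_eq_range, List.range_eq_range', List.map_add_range']
    simp
  rw [h1, h2, h3, List.range_eq_range', List.range_eq_range', show 2 * N + T = N + (T + N) by ring,
    ← List.range'_append, ← List.range'_append]
  simp [Nat.add_comm]

/-- **The record list by lists is `recList`.** [folklore] -/
theorem recListL_eq (hN : 0 < N) {xb : List Bool} {z₀ : QReg N} (hz : ∀ w : Fin N, z₀ w = xb.getD w false) :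
    recListL (wlOf C) N (opsOf C) xb = recList C z₀ ⟨0, hN⟩ := by
  have hT : (wlOf C).length = C.gates.length := List.length_map _
  rw [recListL, hT, recList, ← nodeList_eq_map_code, List.map_map]
  exact List.map_congr_left fun u _ => recOfCode_code hN hz u

end Numbering

end Literature.Barriers.QuantumAdvantage

end
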